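import Mathlib.Probability.Martingale.Convergence
import Literature.Probability.Process.StoppedMartingale
import Literature.Probability.Process.DoobL2Inequality
import Literature.Probability.Process.ContinuousHitting
import HarnessLib

/-!
# Terminal limits of bounded continuous martingales: at infinity, and along a nested family of stopped processes

Topic `Probability/Process`. Two forms of the martingale convergence theorem for **bounded
martingales with a.s. continuous paths** indexed by `ℝ≥0`, for a raw filtration (no usual
conditions), in the hands-on `L²` form (Doob's `L²` maximal inequality on the oscillations plus
orthogonality of martingale increments; no upcrossings):

* `MeasureTheory.Martingale.ae_exists_tendsto_atTop_of_abs_le` — a bounded martingale with a.s.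
  continuous paths converges a.s. as `t → ∞` (the integer skeleton converges by Mathlib's
  discrete martingale convergence theorem, and the oscillation on `[n, n+1]` has second moment
  `≤ 4 (E[M_{n+1}²] - E[M_n²])`, which is summable);
* `Literature.Probability.Process.ae_nested_stoppedProcess_cauchy` — **the local-martingale form
  used to freeze a bounded local martingale at the end of its interval of definition**: if
  `Y : ℝ≥0 → Ω → ℝ` is bounded and `τ₀ ≤ τ₁ ≤ ⋯` are optional times such that every stopped
  process `Y^{τ_k}` is a martingale with a.s. continuous paths, then almost surely the paths
  `r ↦ Y^{τ_J}_r`, `J ≥ k`, are uniformly `ε`-close to the frozen value `Y_{τ_k}` after `τ_k`, for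
  `k` large: `∀ ε > 0, ∃ k, ∀ J ≥ k, ∀ r, |Y^{τ_J}_r - Y^{τ_k}_r| ≤ ε`. In words: the process
  followed along the stopping times is Cauchy at the terminal time `T = sup_k τ_k`, so that
  `lim_{t ↑ T} Y_t` exists whenever `τ_k < T` for all `k` (this is how "`Y_t`, `t < T`, is a
  bounded continuous local martingale, so the a.s. limit `Y_T := lim_{t ↑ T} Y_t` exists" —
  e.g. Lawler–Schramm–Werner (2003), proof of Thm. 6.1 — is consumed without a time change).

The mechanism (all proved here): for a bounded martingale `M` with a.s. continuous paths and an
optional time `σ`, `E[M_t · M^σ_t] = E[(M^σ_t)²]` (`Martingale.integral_mul_stoppedProcess_eq`,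
optional sampling along the dyadic stopping times `σₖ ↓ σ` of `StoppedMartingale` and path
continuity); hence `k ↦ E[(Y^{τ_k}_t)²]` and `t ↦ E[(Y^{τ_k}_t)²]` are non-decreasing and bounded,
`E[(Y^{τ_J}_t - Y^{τ_k}_t)²] = E[(Y^{τ_J}_t)²] - E[(Y^{τ_k}_t)²]`, and Doob's `L²` inequality for the
continuous martingale `Y^{τ_J} - Y^{τ_k}` (`doob_lintegral_iSup_sq_le_of_continuous`) bounds
`E[sup_r (Y^{τ_J}_r - Y^{τ_k}_r)²]` by four times that difference, which tends to `0` as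
`k → ∞` uniformly in `J ≥ k`.

## References

* D. Revuz, M. Yor, *Continuous Martingales and Brownian Motion* (3rd ed., 1999), Ch. II,
  Thm (2.10) (convergence of bounded martingales), Ch. IV, Prop. (1.23) / §1 (continuous local
  martingales on stochastic intervals), Ch. II Thm (1.7) (Doob's `Lᵖ` inequality).
* J.-F. Le Gall, *Brownian Motion, Martingales, and Stochastic Calculus* (2016), Thm 3.22,
  Cor. 3.24 (optional stopping), Prop. 3.8 (dyadic approximation of stopping times).
* G. F. Lawler, O. Schramm, W. Werner, *Conformal restriction: the chordal case*, JAMS 16 (2003),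
  proof of Thm. 6.1 ("By the martingale convergence theorem, the a.s. limit `Y_T` exists").
-/

noncomputable section

open MeasureTheory Filter Set Literature.Probability.Process
open scoped NNReal ENNReal Topology

namespace MeasureTheory.Martingale

variable {Ω : Type*} {m : MeasurableSpace Ω} {𝓕 : Filtration ℝ≥0 m} {P : Measure Ω}
  [IsFiniteMeasure P] {M : ℝ≥0 → Ω → ℝ}

/-! ### Doob's `L²` inequality for the increments after a fixed time -/

/-- The filtration `u ↦ 𝓕 (s + u)` (time shifted by `s`). [folklore] -/
def _root_.MeasureTheory.Filtration.addLeft (𝓕 : Filtration ℝ≥0 m) (s : ℝ≥0) : Filtration ℝ≥0 m :=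
  ⟨fun u ↦ 𝓕 (s + u), fun _ _ h ↦ 𝓕.mono (add_le_add le_rfl h), fun u ↦ 𝓕.le (s + u)⟩

/-- Unfolding of the shifted filtration. [folklore] -/
@[simp] theorem _root_.MeasureTheory.Filtration.addLeft_apply (𝓕 : Filtration ℝ≥0 m) (s u : ℝ≥0) :
    𝓕.addLeft s u = 𝓕 (s + u) := rfl

/-- The increment process `u ↦ M_{s+u} - M_s` of a martingale is a martingale for the shifted
filtration. Revuz–Yor (1999), Ch. II §1. [folklore] -/
theorem shift_sub (hM : Martingale M 𝓕 P) (s : ℝ≥0) :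
    Martingale (fun u ω ↦ M (s + u) ω - M s ω) (𝓕.addLeft s) P := by
  refine ⟨fun u ↦ ?_, fun u v huv ↦ ?_⟩
  · exact (hM.stronglyAdapted (s + u)).sub
      ((hM.stronglyAdapted s).mono (𝓕.mono le_self_add))
  · have hsu : s ≤ s + u := le_self_add
    have h1 : P[M (s + v) | 𝓕.addLeft s u] =ᵐ[P] M (s + u) :=
      hM.condExp_ae_eq (add_le_add le_rfl huv)
    have h2 : P[M s | 𝓕.addLeft s u] = M s := by
      rw [Filtration.addLeft_apply]
      exact condExp_of_stronglyMeasurable (𝓕.le _) ((hM.stronglyAdapted s).mono (𝓕.mono hsu))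
        (hM.integrable s)
    have h3 := condExp_sub (hM.integrable (s + v)) (hM.integrable s) (𝓕.addLeft s u) (μ := P)
    filter_upwards [h1, h3] with ω hω1 hω3
    rw [show (fun ω ↦ M (s + v) ω - M s ω) = M (s + v) - M s from rfl, hω3, Pi.sub_apply, hω1, h2]

/-- **Doob's `L²` inequality for the increments after time `s`** of a square-integrable
martingale with a.s. continuous paths: `E[sup_{r ∈ [s, t]} (M_r - M_s)²] ≤ 4 E[(M_t - M_s)²]`
(Doob's inequality `doob_lintegral_iSup_sq_le_of_continuous` for the shifted martingale
`u ↦ M_{s+u} - M_s`). Revuz–Yor (1999), Ch. II, Thm (1.7). [cite: RevuzYor1999, Ch. II Thm (1.7)] -/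
theorem lintegral_iSup_sq_sub_le (hM : Martingale M 𝓕 P) (hL2 : ∀ r, MemLp (M r) 2 P)
    (hcont : ∀ᵐ ω ∂P, Continuous (M · ω)) {s t : ℝ≥0} (hst : s ≤ t) :
    ∫⁻ ω, ⨆ r ∈ Icc s t, ENNReal.ofReal ((M r ω - M s ω) ^ 2) ∂P ≤
      4 * ∫⁻ ω, ENNReal.ofReal ((M t ω - M s ω) ^ 2) ∂P := by
  have hN := hM.shift_sub s
  have hNL2 : ∀ u, MemLp (fun ω ↦ M (s + u) ω - M s ω) 2 P := fun u ↦ (hL2 (s + u)).sub (hL2 s)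
  have hNcont : ∀ᵐ ω ∂P, Continuous fun u ↦ M (s + u) ω - M s ω := by
    filter_upwards [hcont] with ω hω
    exact (hω.comp (continuous_const.add continuous_id)).sub continuous_const
  have h := doob_lintegral_iSup_sq_le_of_continuous hN hNL2 hNcont (t - s)
  have hts : s + (t - s) = t := add_tsub_cancel_of_le hst
  simp only [hts] at h
  refine le_trans (lintegral_mono fun ω ↦ ?_) h
  refine iSup₂_le fun r hr ↦ ?_
  have hr' : r - s ∈ Iic (t - s) := tsub_le_tsub_right hr.2 s
  have hsr : s + (r - s) = r := add_tsub_cancel_of_le hr.1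
  calc ENNReal.ofReal ((M r ω - M s ω) ^ 2)
      = ENNReal.ofReal ((M (s + (r - s)) ω - M s ω) ^ 2) := by rw [hsr]
    _ ≤ ⨆ u ∈ Iic (t - s), ENNReal.ofReal ((M (s + u) ω - M s ω) ^ 2) :=
        le_iSup₂ (f := fun u (_ : u ∈ Iic (t - s)) ↦ ENNReal.ofReal ((M (s + u) ω - M s ω) ^ 2))
          (r - s) hr'

/-! ### Orthogonality: `E[M_t M_s] = E[M_s²]` and `E[M_t M^σ_t] = E[(M^σ_t)²]` -/

/-- Products `M_r M_{r'}` of a bounded martingale are integrable. [folklore] -/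
theorem integrable_mul (hM : Martingale M 𝓕 P) {C : ℝ} (hC : ∀ r ω, |M r ω| ≤ C) (r r' : ℝ≥0) :
    Integrable (fun ω ↦ M r ω * M r' ω) P := by
  have hmeas : ∀ r, StronglyMeasurable (M r) := fun r ↦ (hM.stronglyAdapted r).mono (𝓕.le r)
  refine Integrable.of_bound ((hmeas r).mul (hmeas r')).aestronglyMeasurable (C * C)
    (Eventually.of_forall fun ω ↦ ?_)
  rw [Real.norm_eq_abs, abs_mul]
  have hC0 : 0 ≤ C := (abs_nonneg _).trans (hC r ω)
  exact mul_le_mul (hC r ω) (hC r' ω) (abs_nonneg _) hC0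

/-- **Orthogonality of increments at fixed times**: `E[M_t · M_s] = E[M_s²]` for `s ≤ t` and a
bounded martingale. Revuz–Yor (1999), Ch. IV, proof of Prop. (1.13) / Ch. II §1. [folklore] -/
theorem integral_mul_eq_integral_sq (hM : Martingale M 𝓕 P) {C : ℝ} (hC : ∀ r ω, |M r ω| ≤ C)
    {s t : ℝ≥0} (hst : s ≤ t) :
    ∫ ω, M t ω * M s ω ∂P = ∫ ω, M s ω ^ 2 ∂P := by
  have h := hM.isAEMartingale.integral_mul_eq hst
    ((hM.stronglyAdapted s).aestronglyMeasurable) (C := C)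
    (Eventually.of_forall fun ω ↦ by rw [Real.norm_eq_abs]; exact hC s ω)
  simp_rw [mul_comm (M s _)] at h
  rw [h]
  congr 1 with ω
  ring

/-- The square of the increment: `E[(M_t - M_s)²] = E[M_t²] - E[M_s²]` for `s ≤ t` and a bounded
martingale. Revuz–Yor (1999), Ch. IV, Prop. (1.13) (`L²`-isometry form). [folklore] -/
theorem integral_sub_sq (hM : Martingale M 𝓕 P) {C : ℝ} (hC : ∀ r ω, |M r ω| ≤ C)
    {s t : ℝ≥0} (hst : s ≤ t) :
    ∫ ω, (M t ω - M s ω) ^ 2 ∂P = ∫ ω, M t ω ^ 2 ∂P - ∫ ω, M s ω ^ 2 ∂P := by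
  have hprod := hM.integrable_mul hC
  have hsq : ∀ r, Integrable (fun ω ↦ M r ω ^ 2) P := fun r ↦ by
    simpa only [pow_two] using hprod r r
  have hexp : ∫ ω, (M t ω - M s ω) ^ 2 ∂P =
      ∫ ω, (M t ω ^ 2 - 2 * (M t ω * M s ω) + M s ω ^ 2) ∂P := by
    congr 1 with ω; ring
  have hi2 : Integrable (fun ω ↦ 2 * (M t ω * M s ω)) P := (hprod t s).const_mul 2
  have hi1 : Integrable (fun ω ↦ M t ω ^ 2 - 2 * (M t ω * M s ω)) P := (hsq t).sub hi2
  rw [hexp, integral_add hi1 (hsq s), integral_sub (hsq t) hi2, integral_const_mul,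
    hM.integral_mul_eq_integral_sq hC hst]
  ring

/-- **Orthogonality of a bounded continuous martingale and its stopped process**:
`E[M_t · M^σ_t] = E[(M^σ_t)²]` for an optional time `σ` (a.s. continuous paths). Along the dyadic
stopping times `σₖ ↓ σ` (countable range) the stopped value `M_{t ∧ σₖ}` is the conditional
expectation `E[M_t | 𝓕_{t ∧ σₖ}]` (Mathlib's discrete optional sampling), whence the identity for
`σₖ`; then `k → ∞` by path continuity and bounded convergence.
Le Gall (2016), Thm 3.22 / Cor. 3.24; Revuz–Yor (1999), Ch. II Thm (3.2). [cite: Legall2016, Thm 3.22 and Cor. 3.24] -/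
theorem integral_mul_stoppedProcess_eq (hM : Martingale M 𝓕 P) {C : ℝ} (hC : ∀ r ω, |M r ω| ≤ C)
    (hcont : ∀ᵐ ω ∂P, Continuous (M · ω)) {σ : Ω → WithTop ℝ≥0}
    (hσ : IsOptionalTime 𝓕 σ) (t : ℝ≥0) :
    ∫ ω, M t ω * stoppedProcess M σ t ω ∂P = ∫ ω, stoppedProcess M σ t ω ^ 2 ∂P := by
  -- dyadic approximation
  set σk : ℕ → Ω → WithTop ℝ≥0 := fun k ω ↦ dyadicCeilTop k (σ ω) with hσk_def
  have hσk : ∀ k, IsStoppingTime 𝓕 (σk k) := fun k ↦ hσ.isStoppingTime_dyadicCeilTop k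
  have hκ : ∀ k, IsStoppingTime 𝓕 (fun ω ↦ min (t : WithTop ℝ≥0) (σk k ω)) := fun k ↦
    (isStoppingTime_const 𝓕 t).min (hσk k)
  have hle : ∀ k (ω : Ω), min (t : WithTop ℝ≥0) (σk k ω) ≤ t := fun k ω ↦ min_le_left _ _
  have hcount : ∀ k, (Set.range fun ω ↦ min (t : WithTop ℝ≥0) (σk k ω)).Countable := by
    intro k
    refine (((countable_range_dyadicCeilTop k)).insert (t : WithTop ℝ≥0)).mono ?_
    rintro _ ⟨ω, rfl⟩
    change min (t : WithTop ℝ≥0) (σk k ω) ∈ _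
    rcases min_choice (t : WithTop ℝ≥0) (σk k ω) with h | h
    · rw [h]; exact Set.mem_insert _ _
    · rw [h]; exact Set.mem_insert_of_mem _ ⟨σ ω, rfl⟩
  -- the identity for each `σₖ`
  have hmeas : ∀ r, StronglyMeasurable (M r) := fun r ↦ (hM.stronglyAdapted r).mono (𝓕.le r)
  have hMt : Integrable (M t) P := hM.integrable t
  have hbd : ∀ k r ω, |stoppedProcess M (σk k) r ω| ≤ C := fun k r ω ↦ hC _ ω
  have hbd' : ∀ r ω, |stoppedProcess M σ r ω| ≤ C := fun r ω ↦ hC _ ω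
  have hSm : ∀ k, StronglyMeasurable (stoppedProcess M (σk k) t) := fun k ↦
    (stronglyMeasurable_stoppedValue_of_countable_range hM.stronglyAdapted (hκ k) (hcount k)
      (hle k)).mono (𝓕.le t)
  have hstep : ∀ k, ∫ ω, M t ω * stoppedProcess M (σk k) t ω ∂P =
      ∫ ω, stoppedProcess M (σk k) t ω ^ 2 ∂P := by
    intro k
    have hopt : stoppedProcess M (σk k) t =ᵐ[P] P[M t | (hκ k).measurableSpace] :=
      hM.stoppedValue_ae_eq_condExp_of_le_const_of_countable_range (hκ k) (hle k) (hcount k)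
    set g : Ω → ℝ := P[M t | (hκ k).measurableSpace] with hg
    have hgm : StronglyMeasurable[(hκ k).measurableSpace] g := stronglyMeasurable_condExp
    have hgb : ∀ᵐ ω ∂P, ‖g ω‖ ≤ C := by
      have := ae_bdd_abs_condExp_of_ae_bdd_abs (m := (hκ k).measurableSpace) (μ := P)
        (f := M t) (R := C) (Eventually.of_forall fun ω ↦ hC t ω)
      filter_upwards [this] with ω hω
      rw [Real.norm_eq_abs]; exact hω
    -- `∫ M t * g = ∫ g * g`
    have hpull : P[g * M t | (hκ k).measurableSpace] =ᵐ[P] g * g := by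
      have h1 := condExp_stronglyMeasurable_mul_of_bound (hκ k).measurableSpace_le hgm hMt C hgb
      exact h1
    have hint_eq : ∫ ω, g ω * M t ω ∂P = ∫ ω, g ω * g ω ∂P := by
      have := integral_condExp (μ := P) (f := g * M t) ((hκ k).measurableSpace_le)
      rw [← show (∫ ω, (g * M t) ω ∂P) = ∫ ω, g ω * M t ω ∂P from rfl, ← this,
        integral_congr_ae hpull]
      rfl
    calc ∫ ω, M t ω * stoppedProcess M (σk k) t ω ∂P = ∫ ω, M t ω * g ω ∂P :=
          integral_congr_ae (by filter_upwards [hopt] with ω hω; rw [hω])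
      _ = ∫ ω, g ω * M t ω ∂P := by simp_rw [mul_comm]
      _ = ∫ ω, g ω * g ω ∂P := hint_eq
      _ = ∫ ω, stoppedProcess M (σk k) t ω ^ 2 ∂P :=
          integral_congr_ae (by filter_upwards [hopt] with ω hω; rw [pow_two, hω])
  -- pass to the limit `k → ∞`
  have hlim : ∀ᵐ ω ∂P, Tendsto (fun k ↦ stoppedProcess M (σk k) t ω) atTop
      (𝓝 (stoppedProcess M σ t ω)) := by
    filter_upwards [hcont] with ω hω
    exact (hω.tendsto _).comp (tendsto_untopA_min_dyadicCeilTop t (σ ω))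
  have hl1 : Tendsto (fun k ↦ ∫ ω, M t ω * stoppedProcess M (σk k) t ω ∂P) atTop
      (𝓝 (∫ ω, M t ω * stoppedProcess M σ t ω ∂P)) := by
    refine tendsto_integral_of_dominated_convergence (fun _ ↦ C * C)
      (fun k ↦ ((hmeas t).mul (hSm k)).aestronglyMeasurable) (integrable_const _)
      (fun k ↦ Eventually.of_forall fun ω ↦ ?_) ?_
    · rw [Real.norm_eq_abs, abs_mul]
      have hC0 : 0 ≤ C := (abs_nonneg _).trans (hC t ω)
      exact mul_le_mul (hC t ω) (hbd k t ω) (abs_nonneg _) hC0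
    · filter_upwards [hlim] with ω hω
      exact tendsto_const_nhds.mul hω
  have hl2 : Tendsto (fun k ↦ ∫ ω, stoppedProcess M (σk k) t ω ^ 2 ∂P) atTop
      (𝓝 (∫ ω, stoppedProcess M σ t ω ^ 2 ∂P)) := by
    refine tendsto_integral_of_dominated_convergence (fun _ ↦ C * C)
      (fun k ↦ ((hSm k).pow 2).aestronglyMeasurable) (integrable_const _)
      (fun k ↦ Eventually.of_forall fun ω ↦ ?_) ?_
    · rw [Real.norm_eq_abs, pow_two, abs_mul]
      have hC0 : 0 ≤ C := (abs_nonneg _).trans (hC t ω)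
      exact mul_le_mul (hbd k t ω) (hbd k t ω) (abs_nonneg _) hC0
    · filter_upwards [hlim] with ω hω
      exact hω.pow 2
  exact tendsto_nhds_unique (by simp_rw [hstep] at hl1; exact hl1) hl2

end MeasureTheory.Martingale


namespace Literature.Probability.Process

variable {Ω : Type*} {m : MeasurableSpace Ω} {𝓕 : Filtration ℝ≥0 m} {P : Measure Ω}

/-! ### Dyadic times and suprema along continuous paths -/

/-- The dyadic time `j / 2ˡ`, indexed by `p = (l, j)`. [folklore] -/
def dyadicPt (p : ℕ × ℕ) : ℝ≥0 := (p.2 : ℝ≥0) / 2 ^ p.1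

/-- Every `r : ℝ≥0` is the limit of the dyadic times `⌊2ˡ r⌋ / 2ˡ`. [folklore] -/
theorem tendsto_dyadicPt_floor (r : ℝ≥0) :
    Tendsto (fun l : ℕ ↦ dyadicPt (l, ⌊r * 2 ^ l⌋₊)) atTop (𝓝 r) :=
  tendsto_nat_floor_div_two_pow r

/-- `⌊2ˡ r⌋ / 2ˡ ≤ r`. [folklore] -/
theorem dyadicPt_floor_le (r : ℝ≥0) (l : ℕ) : dyadicPt (l, ⌊r * 2 ^ l⌋₊) ≤ r :=
  floorGrid_le l r

/-- Along a continuous path, the value at a time `r ≤ t` is dominated by the supremum over the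
dyadic times `≤ t` (for `ENNReal.ofReal ∘ f`). [folklore] -/
theorem ofReal_le_iSup_dyadicPt_le {f : ℝ≥0 → ℝ} (hf : Continuous f) {r t : ℝ≥0} (hrt : r ≤ t) :
    ENNReal.ofReal (f r) ≤ ⨆ (p : ℕ × ℕ) (_ : dyadicPt p ≤ t), ENNReal.ofReal (f (dyadicPt p)) := by
  have htend : Tendsto (fun l : ℕ ↦ ENNReal.ofReal (f (dyadicPt (l, ⌊r * 2 ^ l⌋₊)))) atTop
      (𝓝 (ENNReal.ofReal (f r))) :=
    (ENNReal.continuous_ofReal.tendsto _).comp ((hf.tendsto r).comp (tendsto_dyadicPt_floor r))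
  refine le_of_tendsto' htend fun l ↦ ?_
  exact le_iSup₂ (f := fun p (_ : dyadicPt p ≤ t) ↦ ENNReal.ofReal (f (dyadicPt p)))
    (l, ⌊r * 2 ^ l⌋₊) ((dyadicPt_floor_le r l).trans hrt)

/-- Along a continuous path, every value is dominated by the supremum over all dyadic times.
[folklore] -/
theorem ofReal_le_iSup_dyadicPt {f : ℝ≥0 → ℝ} (hf : Continuous f) (r : ℝ≥0) :
    ENNReal.ofReal (f r) ≤ ⨆ p : ℕ × ℕ, ENNReal.ofReal (f (dyadicPt p)) := by
  refine (ofReal_le_iSup_dyadicPt_le hf le_rfl).trans (iSup₂_le fun p _ ↦ ?_)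
  exact le_iSup (fun p ↦ ENNReal.ofReal (f (dyadicPt p))) p

/-- For a process with measurable marginals and a.s. continuous paths, the running supremum
`ω ↦ sup_{r ≤ t} ofReal (Z r ω)` is a.e.-measurable: it agrees a.s. with the supremum over the
dyadic times. [folklore] -/
theorem aemeasurable_iSup_Iic_of_continuous {Z : ℝ≥0 → Ω → ℝ} (hZ : ∀ r, Measurable (Z r))
    (hcont : ∀ᵐ ω ∂P, Continuous fun r ↦ Z r ω) (t : ℝ≥0) :
    AEMeasurable (fun ω ↦ ⨆ r ∈ Iic t, ENNReal.ofReal (Z r ω)) P := by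
  refine ⟨fun ω ↦ ⨆ (p : ℕ × ℕ) (_ : dyadicPt p ≤ t), ENNReal.ofReal (Z (dyadicPt p) ω), ?_, ?_⟩
  · exact Measurable.iSup fun p ↦ Measurable.iSup_Prop _ (ENNReal.measurable_ofReal.comp (hZ _))
  · filter_upwards [hcont] with ω hω
    refine le_antisymm (iSup₂_le fun r hr ↦ ofReal_le_iSup_dyadicPt_le (f := fun r ↦ Z r ω) hω hr)
      (iSup₂_le fun p hp ↦ ?_)
    exact le_iSup₂ (f := fun r (_ : r ∈ Iic t) ↦ ENNReal.ofReal (Z r ω)) (dyadicPt p) hp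

/-- Same as `aemeasurable_iSup_Iic_of_continuous` for the supremum over all times. [folklore] -/
theorem aemeasurable_iSup_of_continuous {Z : ℝ≥0 → Ω → ℝ} (hZ : ∀ r, Measurable (Z r))
    (hcont : ∀ᵐ ω ∂P, Continuous fun r ↦ Z r ω) :
    AEMeasurable (fun ω ↦ ⨆ r, ENNReal.ofReal (Z r ω)) P := by
  refine ⟨fun ω ↦ ⨆ p : ℕ × ℕ, ENNReal.ofReal (Z (dyadicPt p) ω), ?_, ?_⟩
  · exact Measurable.iSup fun p ↦ ENNReal.measurable_ofReal.comp (hZ _)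
  · filter_upwards [hcont] with ω hω
    refine le_antisymm (iSup_le fun r ↦ ofReal_le_iSup_dyadicPt (f := fun r ↦ Z r ω) hω r)
      (iSup_le fun p ↦ ?_)
    exact le_iSup (fun r ↦ ENNReal.ofReal (Z r ω)) (dyadicPt p)

/-! ### Convergence at infinity of bounded continuous martingales -/

section AtTop

variable [IsFiniteMeasure P] {M : ℝ≥0 → Ω → ℝ}

/-- `E[M_t²] ≤ C² · P(Ω)` for `|M| ≤ C`. [folklore] -/
theorem integral_sq_le_of_abs_le {f : Ω → ℝ} {C : ℝ} (hC : ∀ ω, |f ω| ≤ C) :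
    ∫ ω, f ω ^ 2 ∂P ≤ C ^ 2 * P.real univ := by
  have h : ∀ ω, f ω ^ 2 ≤ C ^ 2 := fun ω ↦ by
    rw [← sq_abs (f ω)]
    exact pow_le_pow_left₀ (abs_nonneg _) (hC ω) 2
  calc ∫ ω, f ω ^ 2 ∂P ≤ ∫ _, C ^ 2 ∂P :=
        integral_mono_of_nonneg (Eventually.of_forall fun ω ↦ sq_nonneg _) (integrable_const _)
          (Eventually.of_forall h)
    _ = C ^ 2 * P.real univ := by rw [integral_const, smul_eq_mul, mul_comm]

/-- **A bounded martingale with a.s. continuous paths converges a.s. at infinity.** The integer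
skeleton `(M_n)` converges a.s. (discrete martingale convergence theorem, Mathlib's
`Submartingale.ae_tendsto_limitProcess`); the oscillation `sup_{r ∈ [n, n+1]} (M_r - M_n)²` has
expectation `≤ 4 (E[M_{n+1}²] - E[M_n²])` by Doob's `L²` inequality, a summable sequence, so it
tends to `0` a.s. Revuz–Yor (1999), Ch. II, Thm (2.10) (convergence theorem for bounded —
indeed uniformly integrable — martingales). [cite: RevuzYor1999, Ch. II Thm (2.10)] -/
theorem _root_.MeasureTheory.Martingale.ae_exists_tendsto_atTop_of_abs_le
    (hM : Martingale M 𝓕 P) {C : ℝ} (hC : ∀ r ω, |M r ω| ≤ C)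
    (hcont : ∀ᵐ ω ∂P, Continuous (M · ω)) :
    ∀ᵐ ω ∂P, ∃ c : ℝ, Tendsto (M · ω) atTop (𝓝 c) := by
  have hmeas : ∀ r, StronglyMeasurable (M r) := fun r ↦ (hM.stronglyAdapted r).mono (𝓕.le r)
  have hL2 : ∀ r, MemLp (M r) 2 P := fun r ↦ MemLp.of_bound (hmeas r).aestronglyMeasurable C
    (Eventually.of_forall fun ω ↦ by rw [Real.norm_eq_abs]; exact hC r ω)
  -- (1) the integer skeleton converges a.s.
  have hnat := hM.reindex_nat (τ := fun n : ℕ ↦ (n : ℝ≥0)) Nat.mono_cast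
  have hbdd : ∀ n : ℕ, eLpNorm (fun ω ↦ M (n : ℝ≥0) ω) 1 P ≤ ((P univ).toNNReal * C.toNNReal : ℝ≥0) := by
    intro n
    refine (eLpNorm_le_of_ae_bound (C := C) (Eventually.of_forall fun ω ↦ ?_)).trans ?_
    · rw [Real.norm_eq_abs]; exact hC _ ω
    · rw [ENNReal.toReal_one, inv_one, ENNReal.rpow_one, ENNReal.coe_mul,
        ENNReal.coe_toNNReal (measure_ne_top P _)]
      rfl
  have hconv := hnat.submartingale.ae_tendsto_limitProcess hbdd
  -- (2) the oscillations over `[n, n+1]`, read at the dyadic times `n + j/2ˡ`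
  set q : ℕ → ℝ := fun n ↦ ∫ ω, M (n : ℝ≥0) ω ^ 2 ∂P with hq
  have hq_mono : Monotone q := by
    refine monotone_nat_of_le_succ fun n ↦ ?_
    have h1 := hM.integral_sub_sq hC (s := (n : ℝ≥0)) (t := ((n + 1 : ℕ) : ℝ≥0)) (by exact_mod_cast n.le_succ)
    have h0 : 0 ≤ ∫ ω, (M ((n + 1 : ℕ) : ℝ≥0) ω - M (n : ℝ≥0) ω) ^ 2 ∂P :=
      integral_nonneg fun ω ↦ sq_nonneg _
    simp only [hq]
    linarith
  have hq_le : ∀ n, q n ≤ C ^ 2 * P.real univ := fun n ↦ integral_sq_le_of_abs_le (hC _)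
  have hq0 : 0 ≤ q 0 := integral_nonneg fun ω ↦ sq_nonneg _
  set Od : ℕ → Ω → ℝ≥0∞ := fun n ω ↦ ⨆ (p : ℕ × ℕ) (_ : dyadicPt p ≤ 1),
    ENNReal.ofReal ((M ((n : ℝ≥0) + dyadicPt p) ω - M (n : ℝ≥0) ω) ^ 2) with hOd
  have hOd_meas : ∀ n, Measurable (Od n) := fun n ↦
    Measurable.iSup fun p ↦ Measurable.iSup_Prop _ (ENNReal.measurable_ofReal.comp
      (((hmeas _).measurable.sub (hmeas _).measurable).pow_const 2))
  have hOd_le : ∀ n, ∫⁻ ω, Od n ω ∂P ≤ 4 * ENNReal.ofReal (q (n + 1) - q n) := by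
    intro n
    have hn1 : ((n : ℝ≥0)) ≤ ((n + 1 : ℕ) : ℝ≥0) := by exact_mod_cast n.le_succ
    have hD := hM.lintegral_iSup_sq_sub_le hL2 hcont hn1
    have hrhs : ∫⁻ ω, ENNReal.ofReal ((M ((n + 1 : ℕ) : ℝ≥0) ω - M (n : ℝ≥0) ω) ^ 2) ∂P =
        ENNReal.ofReal (q (n + 1) - q n) := by
      rw [hq]
      simp only
      rw [← hM.integral_sub_sq hC hn1, ofReal_integral_eq_lintegral_ofReal]
      · exact ((hL2 _).sub (hL2 _)).integrable_sq
      · exact Eventually.of_forall fun ω ↦ sq_nonneg _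
    rw [← hrhs]
    refine le_trans (lintegral_mono fun ω ↦ iSup₂_le fun p hp ↦ ?_) hD
    refine le_iSup₂ (f := fun r (_ : r ∈ Icc (n : ℝ≥0) ((n + 1 : ℕ) : ℝ≥0)) ↦
      ENNReal.ofReal ((M r ω - M (n : ℝ≥0) ω) ^ 2)) ((n : ℝ≥0) + dyadicPt p) ⟨le_self_add, ?_⟩
    push_cast
    exact add_le_add le_rfl hp
  have hsum : ∑' n, ∫⁻ ω, Od n ω ∂P ≤ 4 * ENNReal.ofReal (C ^ 2 * P.real univ) := by
    refine ENNReal.tsum_le_of_sum_range_le fun N ↦ ?_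
    calc ∑ i ∈ Finset.range N, ∫⁻ ω, Od i ω ∂P
        ≤ ∑ i ∈ Finset.range N, 4 * ENNReal.ofReal (q (i + 1) - q i) := Finset.sum_le_sum fun i _ ↦ hOd_le i
      _ = 4 * ENNReal.ofReal (∑ i ∈ Finset.range N, (q (i + 1) - q i)) := by
          rw [← Finset.mul_sum, ENNReal.ofReal_sum_of_nonneg fun i _ ↦ sub_nonneg.2 (hq_mono i.le_succ)]
      _ = 4 * ENNReal.ofReal (q N - q 0) := by rw [Finset.sum_range_sub]
      _ ≤ 4 * ENNReal.ofReal (C ^ 2 * P.real univ) := by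
          gcongr
          linarith [hq_le N]
  have hOd_tendsto : ∀ᵐ ω ∂P, Tendsto (fun n ↦ Od n ω) atTop (𝓝 0) := by
    have hfin : ∫⁻ ω, ∑' n, Od n ω ∂P ≠ ∞ := by
      rw [lintegral_tsum fun n ↦ (hOd_meas n).aemeasurable]
      exact ne_top_of_le_ne_top (ENNReal.mul_ne_top ENNReal.ofNat_ne_top ENNReal.ofReal_ne_top) hsum
    filter_upwards [ae_lt_top' (Measurable.tsum hOd_meas).aemeasurable hfin]
      with ω hω
    exact ENNReal.tendsto_atTop_zero_of_tsum_ne_top hω.ne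
  -- (3) pathwise assembly
  filter_upwards [hconv, hOd_tendsto, hcont] with ω hω1 hω2 hω3
  set c := (Filtration.limitProcess (fun k ω ↦ M ((fun n : ℕ ↦ (n : ℝ≥0)) k) ω)
    ⟨fun k ↦ 𝓕 ((fun n : ℕ ↦ (n : ℝ≥0)) k), fun _ _ h ↦ 𝓕.mono (Nat.mono_cast h),
      fun k ↦ 𝓕.le _⟩ P ω) with hc
  refine ⟨c, Metric.tendsto_atTop.2 fun ε hε ↦ ?_⟩
  have hε3 : 0 < ε / 3 := by positivity
  obtain ⟨N₁, hN₁⟩ := Metric.tendsto_atTop.1 hω1 (ε / 3) hε3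
  obtain ⟨N₂, hN₂⟩ := ENNReal.tendsto_atTop_zero.1 hω2 (ENNReal.ofReal ((ε / 3) ^ 2))
    (ENNReal.ofReal_pos.2 (by positivity))
  refine ⟨((max N₁ N₂ : ℕ) : ℝ≥0), fun t ht ↦ ?_⟩
  set n : ℕ := ⌊t⌋₊ with hn
  have hnt : (n : ℝ≥0) ≤ t := Nat.floor_le zero_le
  have htn : t ≤ (n : ℝ≥0) + 1 := (Nat.lt_floor_add_one t).le
  have hnN : max N₁ N₂ ≤ n := Nat.le_floor ht
  -- the oscillation bound at time `t = n + u`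
  have hu : t - (n : ℝ≥0) ≤ 1 := tsub_le_iff_left.2 htn
  have hosc : ENNReal.ofReal ((M t ω - M (n : ℝ≥0) ω) ^ 2) ≤ Od n ω := by
    have h := ofReal_le_iSup_dyadicPt_le
      (f := fun u ↦ (M ((n : ℝ≥0) + u) ω - M (n : ℝ≥0) ω) ^ 2)
      (((hω3.comp (continuous_const.add continuous_id)).sub continuous_const).pow 2) hu
    simp only [add_tsub_cancel_of_le hnt] at h
    exact h
  have h1 : (M t ω - M (n : ℝ≥0) ω) ^ 2 ≤ (ε / 3) ^ 2 :=
    (ENNReal.ofReal_le_ofReal_iff (by positivity)).1 ((hosc.trans (hN₂ n (le_of_max_le_right hnN))))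
  have h2 : |M t ω - M (n : ℝ≥0) ω| ≤ ε / 3 := abs_le_of_sq_le_sq h1 hε3.le
  have h3 : dist (M (n : ℝ≥0) ω) c < ε / 3 := hN₁ n (le_of_max_le_left hnN)
  calc dist (M t ω) c ≤ dist (M t ω) (M (n : ℝ≥0) ω) + dist (M (n : ℝ≥0) ω) c := dist_triangle _ _ _
    _ < ε / 3 + ε / 3 := by
        refine add_lt_add_of_le_of_lt ?_ h3
        rw [Real.dist_eq]; exact h2
    _ ≤ ε := by linarith

end AtTop


/-! ### Nested stopped processes: pathwise bookkeeping -/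

section NestedPath

variable {Y : ℝ≥0 → Ω → ℝ} {τ : ℕ → Ω → WithTop ℝ≥0}

/-- The stopped clock `r ∧ x`, read back in `WithTop ℝ≥0`, is `min r x`. [folklore] -/
theorem coe_untopA_min (r : ℝ≥0) (x : WithTop ℝ≥0) :
    (((min (r : WithTop ℝ≥0) x).untopA : ℝ≥0) : WithTop ℝ≥0) = min (r : WithTop ℝ≥0) x := by
  induction x with
  | top => rw [min_eq_left le_top]; rfl
  | coe t₀ => rw [← WithTop.coe_min]; rfl

/-- Stopping first at `ρ` and then at an earlier time `σ ≤ ρ` is stopping at `σ`. [folklore] -/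
theorem stoppedProcess_stoppedProcess_of_le {σ ρ : Ω → WithTop ℝ≥0} (h : ∀ ω, σ ω ≤ ρ ω) :
    stoppedProcess (stoppedProcess Y ρ) σ = stoppedProcess Y σ := by
  rw [stoppedProcess_stoppedProcess]
  congr 1
  funext ω
  simp only [Pi.inf_apply]
  exact inf_eq_left.2 (h ω)

/-- **Nesting**: for `τ_k ≤ τ_J ≤ τ_{J'}`, the pair of values `(Y^{τ_J}_r, Y^{τ_k}_r)` at time `r`
is the pair `(Y^{τ_{J'}}_{r'}, Y^{τ_k}_{r'})` at the earlier time `r' = r ∧ τ_J`. [folklore] -/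
theorem exists_stoppedProcess_nested_eq (hτ : ∀ ω, Monotone (τ · ω)) {k J J' : ℕ} (hkJ : k ≤ J)
    (hJJ' : J ≤ J') (r : ℝ≥0) (ω : Ω) :
    ∃ r' : ℝ≥0, stoppedProcess Y (τ J) r ω = stoppedProcess Y (τ J') r' ω ∧
      stoppedProcess Y (τ k) r ω = stoppedProcess Y (τ k) r' ω := by
  refine ⟨(min (r : WithTop ℝ≥0) (τ J ω)).untopA, ?_, ?_⟩
  · simp only [stoppedProcess]
    rw [coe_untopA_min, min_eq_left ((min_le_right _ _).trans (hτ ω hJJ'))]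
  · simp only [stoppedProcess]
    rw [coe_untopA_min, min_assoc, min_eq_right (hτ ω hkJ)]

/-- After `τ_k`, the process stopped at `τ_k` is frozen at `Y_{τ_k}`: its values at two times
`≥ τ_k` agree. [folklore] -/
theorem stoppedProcess_eq_of_le_of_le {σ : Ω → WithTop ℝ≥0} {r r' : ℝ≥0} {ω : Ω}
    (hr : σ ω ≤ r) (hr' : σ ω ≤ r') : stoppedProcess Y σ r ω = stoppedProcess Y σ r' ω := by
  rw [stoppedProcess_eq_of_ge hr, stoppedProcess_eq_of_ge hr']

end NestedPath

/-! ### Nested stopped processes: Cauchy at the terminal time -/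

section Nested

variable [IsFiniteMeasure P] {Y : ℝ≥0 → Ω → ℝ} {τ : ℕ → Ω → WithTop ℝ≥0} {C : ℝ}

/-- Products of bounded strongly measurable functions are integrable. [folklore] -/
theorem integrable_mul_of_abs_le {f g : Ω → ℝ} (hf : StronglyMeasurable f) (hg : StronglyMeasurable g)
    {a b : ℝ} (ha : ∀ ω, |f ω| ≤ a) (hb : ∀ ω, |g ω| ≤ b) : Integrable (fun ω ↦ f ω * g ω) P := by
  refine Integrable.of_bound (hf.mul hg).aestronglyMeasurable (a * b)
    (Eventually.of_forall fun ω ↦ ?_)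
  rw [Real.norm_eq_abs, abs_mul]
  exact mul_le_mul (ha ω) (hb ω) (abs_nonneg _) ((abs_nonneg _).trans (ha ω))

/-- `∫ (f - g)² = ∫ f² - ∫ g²` when `∫ f g = ∫ g²` (orthogonality), for bounded `f, g`. [folklore] -/
theorem integral_sub_sq_of_orth {f g : Ω → ℝ} (hf : StronglyMeasurable f) (hg : StronglyMeasurable g)
    {a b : ℝ} (ha : ∀ ω, |f ω| ≤ a) (hb : ∀ ω, |g ω| ≤ b)
    (horth : ∫ ω, f ω * g ω ∂P = ∫ ω, g ω ^ 2 ∂P) :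
    ∫ ω, (f ω - g ω) ^ 2 ∂P = ∫ ω, f ω ^ 2 ∂P - ∫ ω, g ω ^ 2 ∂P := by
  have hff : Integrable (fun ω ↦ f ω ^ 2) P := by
    simpa only [pow_two] using integrable_mul_of_abs_le hf hf ha ha
  have hgg : Integrable (fun ω ↦ g ω ^ 2) P := by
    simpa only [pow_two] using integrable_mul_of_abs_le hg hg hb hb
  have hfg : Integrable (fun ω ↦ 2 * (f ω * g ω)) P := (integrable_mul_of_abs_le hf hg ha hb).const_mul 2
  have hexp : ∫ ω, (f ω - g ω) ^ 2 ∂P = ∫ ω, (f ω ^ 2 - 2 * (f ω * g ω) + g ω ^ 2) ∂P := by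
    congr 1 with ω; ring
  have hi1 : Integrable (fun ω ↦ f ω ^ 2 - 2 * (f ω * g ω)) P := hff.sub hfg
  rw [hexp, integral_add hi1 hgg, integral_sub hff hfg, integral_const_mul, horth]
  ring

variable (hτ : ∀ ω, Monotone (τ · ω)) (hopt : ∀ k, IsOptionalTime 𝓕 (τ k))
  (hX : ∀ k, Martingale (stoppedProcess Y (τ k)) 𝓕 P) (hC : ∀ t ω, |Y t ω| ≤ C)
  (hcont : ∀ k, ∀ᵐ ω ∂P, Continuous fun t ↦ stoppedProcess Y (τ k) t ω)

omit [IsFiniteMeasure P] in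
include hX in
/-- The stopped processes have strongly measurable marginals. [folklore] -/
theorem stronglyMeasurable_stoppedProcess_nested (k : ℕ) (r : ℝ≥0) :
    StronglyMeasurable (stoppedProcess Y (τ k) r) :=
  ((hX k).stronglyAdapted r).mono (𝓕.le r)

include hτ hopt hX hC hcont in
/-- **Orthogonality along the nested family**: `E[Y^{τ_J}_t · Y^{τ_k}_t] = E[(Y^{τ_k}_t)²]` for
`k ≤ J` (`Y^{τ_k}` is `Y^{τ_J}` stopped at the optional time `τ_k`). [folklore] -/
theorem integral_mul_stoppedProcess_nested {k J : ℕ} (hkJ : k ≤ J) (t : ℝ≥0) :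
    ∫ ω, stoppedProcess Y (τ J) t ω * stoppedProcess Y (τ k) t ω ∂P =
      ∫ ω, stoppedProcess Y (τ k) t ω ^ 2 ∂P := by
  have h := (hX J).integral_mul_stoppedProcess_eq (C := C) (fun r ω ↦ hC _ ω) (hcont J) (hopt k) t
  rwa [stoppedProcess_stoppedProcess_of_le (fun ω ↦ hτ ω hkJ)] at h

include hτ hopt hX hC hcont in
/-- `E[(Y^{τ_J}_t - Y^{τ_k}_t)²] = E[(Y^{τ_J}_t)²] - E[(Y^{τ_k}_t)²]` for `k ≤ J`. [folklore] -/
theorem integral_sub_sq_stoppedProcess_nested {k J : ℕ} (hkJ : k ≤ J) (t : ℝ≥0) :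
    ∫ ω, (stoppedProcess Y (τ J) t ω - stoppedProcess Y (τ k) t ω) ^ 2 ∂P =
      ∫ ω, stoppedProcess Y (τ J) t ω ^ 2 ∂P - ∫ ω, stoppedProcess Y (τ k) t ω ^ 2 ∂P :=
  integral_sub_sq_of_orth (stronglyMeasurable_stoppedProcess_nested hX J t)
    (stronglyMeasurable_stoppedProcess_nested hX k t) (fun ω ↦ hC _ ω) (fun ω ↦ hC _ ω)
    (integral_mul_stoppedProcess_nested hτ hopt hX hC hcont hkJ t)

/-- The second moments `q k n = E[(Y^{τ_k}_n)²]` at integer times. [folklore] -/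
def sqMoment (P : Measure Ω) (Y : ℝ≥0 → Ω → ℝ) (τ : ℕ → Ω → WithTop ℝ≥0) (k n : ℕ) : ℝ :=
  ∫ ω, stoppedProcess Y (τ k) (n : ℝ≥0) ω ^ 2 ∂P

include hC in
/-- `0 ≤ q k n ≤ C² P(Ω)`. [folklore] -/
theorem sqMoment_mem_Icc (k n : ℕ) : sqMoment P Y τ k n ∈ Icc 0 (C ^ 2 * P.real univ) :=
  ⟨integral_nonneg fun _ ↦ sq_nonneg _, integral_sq_le_of_abs_le fun ω ↦ hC _ ω⟩

include hX hC in
/-- `n ↦ q k n` is non-decreasing (the square of a martingale is a submartingale). [folklore] -/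
theorem monotone_sqMoment_right (k : ℕ) : Monotone (sqMoment P Y τ k) := by
  refine monotone_nat_of_le_succ fun n ↦ ?_
  have hn : ((n : ℝ≥0)) ≤ ((n + 1 : ℕ) : ℝ≥0) := by exact_mod_cast n.le_succ
  have h1 := (hX k).integral_sub_sq (fun r ω ↦ hC _ ω) hn
  have h0 : 0 ≤ ∫ ω, (stoppedProcess Y (τ k) ((n + 1 : ℕ) : ℝ≥0) ω -
      stoppedProcess Y (τ k) (n : ℝ≥0) ω) ^ 2 ∂P := integral_nonneg fun ω ↦ sq_nonneg _
  simp only [sqMoment]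
  linarith

include hτ hopt hX hC hcont in
/-- `k ↦ q k n` is non-decreasing (orthogonality). [folklore] -/
theorem monotone_sqMoment_left (n : ℕ) : Monotone fun k ↦ sqMoment P Y τ k n := by
  refine monotone_nat_of_le_succ fun k ↦ ?_
  have h1 := integral_sub_sq_stoppedProcess_nested hτ hopt hX hC hcont k.le_succ (n : ℝ≥0)
  have h0 : 0 ≤ ∫ ω, (stoppedProcess Y (τ (k + 1)) (n : ℝ≥0) ω -
      stoppedProcess Y (τ k) (n : ℝ≥0) ω) ^ 2 ∂P := integral_nonneg fun ω ↦ sq_nonneg _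
  simp only [sqMoment] at h1 ⊢
  linarith

include hτ hopt hX hC hcont in
/-- For `k ≤ J`, `n ↦ q J n - q k n = E[(Y^{τ_J}_n - Y^{τ_k}_n)²]` is non-decreasing (the
difference `Y^{τ_J} - Y^{τ_k}` is a martingale). [folklore] -/
theorem monotone_sqMoment_sub {k J : ℕ} (hkJ : k ≤ J) :
    Monotone fun n ↦ sqMoment P Y τ J n - sqMoment P Y τ k n := by
  refine monotone_nat_of_le_succ fun n ↦ ?_
  have hn : ((n : ℝ≥0)) ≤ ((n + 1 : ℕ) : ℝ≥0) := by exact_mod_cast n.le_succ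
  have hD : Martingale (stoppedProcess Y (τ J) - stoppedProcess Y (τ k)) 𝓕 P := (hX J).sub (hX k)
  have hDC : ∀ r ω, |(stoppedProcess Y (τ J) - stoppedProcess Y (τ k)) r ω| ≤ C + C := fun r ω ↦ by
    simp only [Pi.sub_apply]
    exact (abs_sub _ _).trans (add_le_add (hC _ ω) (hC _ ω))
  have h1 := hD.integral_sub_sq hDC hn
  have h0 : 0 ≤ ∫ ω, ((stoppedProcess Y (τ J) - stoppedProcess Y (τ k)) ((n + 1 : ℕ) : ℝ≥0) ω -
      (stoppedProcess Y (τ J) - stoppedProcess Y (τ k)) (n : ℝ≥0) ω) ^ 2 ∂P :=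
    integral_nonneg fun ω ↦ sq_nonneg _
  have e1 := integral_sub_sq_stoppedProcess_nested hτ hopt hX hC hcont hkJ ((n + 1 : ℕ) : ℝ≥0)
  have e0 := integral_sub_sq_stoppedProcess_nested hτ hopt hX hC hcont hkJ (n : ℝ≥0)
  simp only [Pi.sub_apply] at h1 h0
  simp only [sqMoment]
  linarith

/-- The limits `qlim k = sup_n q k n` and `Q = sup_k qlim k`. [folklore] -/
def sqMomentLim (P : Measure Ω) (Y : ℝ≥0 → Ω → ℝ) (τ : ℕ → Ω → WithTop ℝ≥0) (k : ℕ) : ℝ :=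
  ⨆ n : ℕ, sqMoment P Y τ k n

/-- `Q = sup_k qlim k`. [folklore] -/
def sqMomentSup (P : Measure Ω) (Y : ℝ≥0 → Ω → ℝ) (τ : ℕ → Ω → WithTop ℝ≥0) : ℝ :=
  ⨆ k : ℕ, sqMomentLim P Y τ k

include hC in
/-- The second moments are bounded. [folklore] -/
theorem bddAbove_sqMoment (k : ℕ) : BddAbove (range (sqMoment P Y τ k)) :=
  ⟨C ^ 2 * P.real univ, by rintro _ ⟨n, rfl⟩; exact (sqMoment_mem_Icc hC k n).2⟩

include hC in
/-- `qlim k ≤ C² P(Ω)`. [folklore] -/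
theorem sqMomentLim_le (k : ℕ) : sqMomentLim P Y τ k ≤ C ^ 2 * P.real univ :=
  ciSup_le fun n ↦ (sqMoment_mem_Icc hC k n).2

include hC in
/-- The limits `qlim k` are bounded. [folklore] -/
theorem bddAbove_sqMomentLim : BddAbove (range (sqMomentLim P Y τ)) :=
  ⟨C ^ 2 * P.real univ, by rintro _ ⟨k, rfl⟩; exact sqMomentLim_le hC k⟩

include hX hC in
/-- `q k n → qlim k` as `n → ∞` (monotone bounded). [folklore] -/
theorem tendsto_sqMoment (k : ℕ) :
    Tendsto (sqMoment P Y τ k) atTop (𝓝 (sqMomentLim P Y τ k)) :=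
  tendsto_atTop_ciSup (monotone_sqMoment_right hX hC k) (bddAbove_sqMoment hC k)

include hτ hopt hX hC hcont in
/-- `k ↦ qlim k` is non-decreasing. [folklore] -/
theorem monotone_sqMomentLim : Monotone (sqMomentLim P Y τ) := fun _ J hkJ ↦
  ciSup_mono (bddAbove_sqMoment hC J) fun n ↦ monotone_sqMoment_left hτ hopt hX hC hcont n hkJ

include hτ hopt hX hC hcont in
/-- `qlim k → Q` as `k → ∞` (monotone bounded). [folklore] -/
theorem tendsto_sqMomentLim :
    Tendsto (sqMomentLim P Y τ) atTop (𝓝 (sqMomentSup P Y τ)) :=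
  tendsto_atTop_ciSup (monotone_sqMomentLim hτ hopt hX hC hcont) (bddAbove_sqMomentLim hC)

include hτ hopt hX hC hcont in
/-- `q J n - q k n ≤ Q - qlim k` for `k ≤ J`. [folklore] -/
theorem sqMoment_sub_le {k J : ℕ} (hkJ : k ≤ J) (n : ℕ) :
    sqMoment P Y τ J n - sqMoment P Y τ k n ≤ sqMomentSup P Y τ - sqMomentLim P Y τ k := by
  have h1 : sqMoment P Y τ J n - sqMoment P Y τ k n ≤ sqMomentLim P Y τ J - sqMomentLim P Y τ k :=
    (monotone_sqMoment_sub hτ hopt hX hC hcont hkJ).ge_of_tendsto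
      ((tendsto_sqMoment hX hC J).sub (tendsto_sqMoment hX hC k)) n
  have h2 : sqMomentLim P Y τ J ≤ sqMomentSup P Y τ := le_ciSup (bddAbove_sqMomentLim hC) J
  linarith

include hτ hopt hX hC hcont in
/-- **Doob's inequality for the nested differences**:
`E[sup_{r ≤ n} (Y^{τ_J}_r - Y^{τ_k}_r)²] ≤ 4 (Q - qlim k)` for `k ≤ J`. [folklore] -/
theorem lintegral_iSup_Iic_sub_sq_le {k J : ℕ} (hkJ : k ≤ J) (n : ℕ) :
    ∫⁻ ω, ⨆ r ∈ Iic (n : ℝ≥0), ENNReal.ofReal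
        ((stoppedProcess Y (τ J) r ω - stoppedProcess Y (τ k) r ω) ^ 2) ∂P ≤
      4 * ENNReal.ofReal (sqMomentSup P Y τ - sqMomentLim P Y τ k) := by
  have hD : Martingale (stoppedProcess Y (τ J) - stoppedProcess Y (τ k)) 𝓕 P := (hX J).sub (hX k)
  have hmeas := stronglyMeasurable_stoppedProcess_nested hX
  have hDL2 : ∀ r, MemLp ((stoppedProcess Y (τ J) - stoppedProcess Y (τ k)) r) 2 P := fun r ↦
    MemLp.of_bound ((hmeas J r).sub (hmeas k r)).aestronglyMeasurable (C + C)
      (Eventually.of_forall fun ω ↦ by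
        rw [Real.norm_eq_abs, Pi.sub_apply]
        exact (abs_sub _ _).trans (add_le_add (hC _ ω) (hC _ ω)))
  have hDcont : ∀ᵐ ω ∂P, Continuous fun r ↦ (stoppedProcess Y (τ J) - stoppedProcess Y (τ k)) r ω := by
    filter_upwards [hcont J, hcont k] with ω hJ hk
    exact hJ.sub hk
  have hDoob := doob_lintegral_iSup_sq_le_of_continuous hD hDL2 hDcont (n : ℝ≥0)
  simp only [Pi.sub_apply] at hDoob
  refine hDoob.trans ?_
  have hint : Integrable (fun ω ↦ (stoppedProcess Y (τ J) (n : ℝ≥0) ω -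
      stoppedProcess Y (τ k) (n : ℝ≥0) ω) ^ 2) P := by
    have := (hDL2 (n : ℝ≥0)).integrable_sq
    simpa only [Pi.sub_apply] using this
  rw [← ofReal_integral_eq_lintegral_ofReal hint (Eventually.of_forall fun ω ↦ sq_nonneg _),
    integral_sub_sq_stoppedProcess_nested hτ hopt hX hC hcont hkJ]
  exact mul_le_mul' le_rfl (ENNReal.ofReal_le_ofReal (sqMoment_sub_le hτ hopt hX hC hcont hkJ n))

/-- The squared oscillation functional `W k J ω = sup_r (Y^{τ_J}_r - Y^{τ_k}_r)²` and its
supremum over `J ≥ k`, `V k ω = sup_n W k (k + n) ω` (values in `ℝ≥0∞`). [folklore] -/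
def sqOsc (Y : ℝ≥0 → Ω → ℝ) (τ : ℕ → Ω → WithTop ℝ≥0) (k J : ℕ) (ω : Ω) : ℝ≥0∞ :=
  ⨆ r : ℝ≥0, ENNReal.ofReal ((stoppedProcess Y (τ J) r ω - stoppedProcess Y (τ k) r ω) ^ 2)

/-- `V k = sup_{J ≥ k} W k J`. [folklore] -/
def sqOscSup (Y : ℝ≥0 → Ω → ℝ) (τ : ℕ → Ω → WithTop ℝ≥0) (k : ℕ) (ω : Ω) : ℝ≥0∞ :=
  ⨆ n : ℕ, sqOsc Y τ k (k + n) ω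

omit [IsFiniteMeasure P] in
/-- Each squared difference is dominated by `V k` (`J ≥ k`). [folklore] -/
theorem ofReal_sub_sq_le_sqOscSup {k J : ℕ} (hkJ : k ≤ J) (r : ℝ≥0) (ω : Ω) :
    ENNReal.ofReal ((stoppedProcess Y (τ J) r ω - stoppedProcess Y (τ k) r ω) ^ 2) ≤
      sqOscSup Y τ k ω := by
  obtain ⟨n, rfl⟩ := Nat.exists_eq_add_of_le hkJ
  exact (le_iSup (fun r ↦ ENNReal.ofReal
    ((stoppedProcess Y (τ (k + n)) r ω - stoppedProcess Y (τ k) r ω) ^ 2)) r).trans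
    (le_iSup (fun n ↦ sqOsc Y τ k (k + n) ω) n)

omit [IsFiniteMeasure P] in
include hτ in
/-- `J ↦ W k J` is non-decreasing on `J ≥ k` (nesting). [folklore] -/
theorem sqOsc_mono {k J J' : ℕ} (hkJ : k ≤ J) (hJJ' : J ≤ J') (ω : Ω) :
    sqOsc Y τ k J ω ≤ sqOsc Y τ k J' ω := by
  refine iSup_le fun r ↦ ?_
  obtain ⟨r', h1, h2⟩ := exists_stoppedProcess_nested_eq (Y := Y) hτ hkJ hJJ' r ω
  rw [h1, h2]
  exact le_iSup (fun r ↦ ENNReal.ofReal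
    ((stoppedProcess Y (τ J') r ω - stoppedProcess Y (τ k) r ω) ^ 2)) r'

omit [IsFiniteMeasure P] in
/-- **Quasi-monotonicity**: `V k' ≤ 4 V k` for `k ≤ k'` (`(a - b)² ≤ 2(a - c)² + 2(b - c)²`).
[folklore] -/
theorem sqOscSup_le_four_mul {k k' : ℕ} (hkk' : k ≤ k') (ω : Ω) :
    sqOscSup Y τ k' ω ≤ 4 * sqOscSup Y τ k ω := by
  refine iSup_le fun n ↦ iSup_le fun r ↦ ?_
  set a := stoppedProcess Y (τ (k' + n)) r ω - stoppedProcess Y (τ k) r ω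
  set b := stoppedProcess Y (τ k') r ω - stoppedProcess Y (τ k) r ω
  have hab : stoppedProcess Y (τ (k' + n)) r ω - stoppedProcess Y (τ k') r ω = a - b := by
    simp only [a, b]; ring
  have hineq : (a - b) ^ 2 ≤ 2 * a ^ 2 + 2 * b ^ 2 := by nlinarith [sq_nonneg (a + b)]
  have ha : ENNReal.ofReal (a ^ 2) ≤ sqOscSup Y τ k ω :=
    ofReal_sub_sq_le_sqOscSup (hkk'.trans (Nat.le_add_right _ _)) r ω
  have hb : ENNReal.ofReal (b ^ 2) ≤ sqOscSup Y τ k ω := ofReal_sub_sq_le_sqOscSup hkk' r ω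
  rw [hab]
  calc ENNReal.ofReal ((a - b) ^ 2) ≤ ENNReal.ofReal (2 * a ^ 2 + 2 * b ^ 2) :=
        ENNReal.ofReal_le_ofReal hineq
    _ = 2 * ENNReal.ofReal (a ^ 2) + 2 * ENNReal.ofReal (b ^ 2) := by
        rw [ENNReal.ofReal_add (by positivity) (by positivity), ENNReal.ofReal_mul zero_le_two,
          ENNReal.ofReal_mul zero_le_two, ENNReal.ofReal_ofNat]
    _ ≤ 2 * sqOscSup Y τ k ω + 2 * sqOscSup Y τ k ω := by gcongr
    _ = 4 * sqOscSup Y τ k ω := by rw [← add_mul]; norm_num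

omit [IsFiniteMeasure P] in
include hX hcont in
/-- `W k J` is a.e.-measurable. [folklore] -/
theorem aemeasurable_sqOsc (k J : ℕ) : AEMeasurable (sqOsc Y τ k J) P := by
  have hmeas := stronglyMeasurable_stoppedProcess_nested hX
  refine aemeasurable_iSup_of_continuous
    (Z := fun r ω ↦ (stoppedProcess Y (τ J) r ω - stoppedProcess Y (τ k) r ω) ^ 2)
    (fun r ↦ ((hmeas J r).measurable.sub (hmeas k r).measurable).pow_const 2) ?_
  filter_upwards [hcont J, hcont k] with ω hJ hk
  exact (hJ.sub hk).pow 2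

omit [IsFiniteMeasure P] in
include hX hcont in
/-- `V k` is a.e.-measurable. [folklore] -/
theorem aemeasurable_sqOscSup (k : ℕ) : AEMeasurable (sqOscSup Y τ k) P :=
  AEMeasurable.iSup fun n ↦ aemeasurable_sqOsc hX hcont k (k + n)

include hτ hopt hX hC hcont in
/-- `E[W k J] ≤ 4 (Q - qlim k)` for `k ≤ J` (monotone convergence in the time horizon).
[folklore] -/
theorem lintegral_sqOsc_le {k J : ℕ} (hkJ : k ≤ J) :
    ∫⁻ ω, sqOsc Y τ k J ω ∂P ≤ 4 * ENNReal.ofReal (sqMomentSup P Y τ - sqMomentLim P Y τ k) := by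
  have hmeas := stronglyMeasurable_stoppedProcess_nested hX
  set F : ℕ → Ω → ℝ≥0∞ := fun n ω ↦ ⨆ r ∈ Iic (n : ℝ≥0), ENNReal.ofReal
    ((stoppedProcess Y (τ J) r ω - stoppedProcess Y (τ k) r ω) ^ 2) with hF
  have hFm : ∀ n, AEMeasurable (F n) P := fun n ↦ by
    refine aemeasurable_iSup_Iic_of_continuous
      (Z := fun r ω ↦ (stoppedProcess Y (τ J) r ω - stoppedProcess Y (τ k) r ω) ^ 2)
      (fun r ↦ ((hmeas J r).measurable.sub (hmeas k r).measurable).pow_const 2) ?_ _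
    filter_upwards [hcont J, hcont k] with ω hJ hk
    exact (hJ.sub hk).pow 2
  have hFmono : ∀ ω, Monotone fun n ↦ F n ω := fun ω n n' hnn' ↦
    biSup_mono fun r (hr : r ∈ Iic (n : ℝ≥0)) ↦ (show r ≤ (n : ℝ≥0) from hr).trans (by exact_mod_cast hnn')
  have hsup : ∀ ω, sqOsc Y τ k J ω = ⨆ n, F n ω := by
    intro ω
    refine le_antisymm (iSup_le fun r ↦ ?_) (iSup_le fun n ↦ iSup₂_le fun r _ ↦ le_iSup (fun r ↦
      ENNReal.ofReal ((stoppedProcess Y (τ J) r ω - stoppedProcess Y (τ k) r ω) ^ 2)) r)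
    refine le_iSup_of_le (f := fun n ↦ F n ω) ⌈r⌉₊ ?_
    exact le_iSup₂ (f := fun u (_ : u ∈ Iic ((⌈r⌉₊ : ℕ) : ℝ≥0)) ↦ ENNReal.ofReal
      ((stoppedProcess Y (τ J) u ω - stoppedProcess Y (τ k) u ω) ^ 2)) r (Nat.le_ceil r)
  simp_rw [hsup]
  rw [lintegral_iSup' hFm (Eventually.of_forall hFmono)]
  exact iSup_le fun n ↦ lintegral_iSup_Iic_sub_sq_le hτ hopt hX hC hcont hkJ n

include hτ hopt hX hC hcont in
/-- `E[V k] ≤ 4 (Q - qlim k)` (monotone convergence in `J`). [folklore] -/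
theorem lintegral_sqOscSup_le (k : ℕ) :
    ∫⁻ ω, sqOscSup Y τ k ω ∂P ≤ 4 * ENNReal.ofReal (sqMomentSup P Y τ - sqMomentLim P Y τ k) := by
  simp only [sqOscSup]
  rw [lintegral_iSup' (fun n ↦ aemeasurable_sqOsc hX hcont k (k + n)) (Eventually.of_forall
    fun ω n n' hnn' ↦ sqOsc_mono hτ (Nat.le_add_right k n) (by omega) ω)]
  exact iSup_le fun n ↦ lintegral_sqOsc_le hτ hopt hX hC hcont (Nat.le_add_right k n)

include hτ hopt hX hC hcont in
/-- `E[V k] → 0`. [folklore] -/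
theorem tendsto_lintegral_sqOscSup :
    Tendsto (fun k ↦ ∫⁻ ω, sqOscSup Y τ k ω ∂P) atTop (𝓝 0) := by
  have h1 : Tendsto (fun k ↦ 4 * ENNReal.ofReal (sqMomentSup P Y τ - sqMomentLim P Y τ k)) atTop
      (𝓝 0) := by
    have h := (tendsto_const_nhds (x := sqMomentSup P Y τ)).sub (tendsto_sqMomentLim hτ hopt hX hC hcont)
    rw [sub_self] at h
    have h' := (ENNReal.continuous_ofReal.tendsto 0).comp h
    rw [ENNReal.ofReal_zero] at h'
    have h'' := ENNReal.Tendsto.const_mul h' (Or.inr ENNReal.ofNat_ne_top) (a := 4)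
    rwa [mul_zero] at h''
  exact tendsto_of_tendsto_of_tendsto_of_le_of_le tendsto_const_nhds h1 (fun _ ↦ zero_le)
    fun k ↦ lintegral_sqOscSup_le hτ hopt hX hC hcont k

include hτ hopt hX hC hcont in
/-- **`V k → 0` almost surely** (a subsequence with summable expectations, then
quasi-monotonicity). [folklore] -/
theorem ae_tendsto_sqOscSup : ∀ᵐ ω ∂P, Tendsto (fun k ↦ sqOscSup Y τ k ω) atTop (𝓝 0) := by
  have hlim := tendsto_lintegral_sqOscSup hτ hopt hX hC hcont
  -- a subsequence `κ i` with `E[V (κ i)] ≤ 2⁻ⁱ`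
  have hex : ∀ i : ℕ, ∃ k, ∫⁻ ω, sqOscSup Y τ k ω ∂P ≤ (2⁻¹ : ℝ≥0∞) ^ i := fun i ↦ by
    obtain ⟨N, hN⟩ := ENNReal.tendsto_atTop_zero.1 hlim ((2⁻¹ : ℝ≥0∞) ^ i)
      (ENNReal.pow_pos (ENNReal.inv_pos.2 ENNReal.ofNat_ne_top) i)
    exact ⟨N, hN N le_rfl⟩
  choose κ hκ using hex
  have hsum : ∫⁻ ω, ∑' i, sqOscSup Y τ (κ i) ω ∂P ≠ ∞ := by
    rw [lintegral_tsum fun i ↦ aemeasurable_sqOscSup hX hcont (κ i)]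
    refine ne_top_of_le_ne_top (b := ∑' i : ℕ, (2⁻¹ : ℝ≥0∞) ^ i) ?_ (ENNReal.tsum_le_tsum hκ)
    rw [ENNReal.tsum_geometric, ENNReal.one_sub_inv_two, inv_inv]
    exact ENNReal.ofNat_ne_top
  filter_upwards [ae_lt_top' (AEMeasurable.tsum fun i ↦ aemeasurable_sqOscSup hX hcont (κ i))
    hsum] with ω hω
  have hsub : Tendsto (fun i ↦ sqOscSup Y τ (κ i) ω) atTop (𝓝 0) :=
    ENNReal.tendsto_atTop_zero_of_tsum_ne_top hω.ne
  refine ENNReal.tendsto_atTop_zero.2 fun ε hε ↦ ?_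
  have hε4 : 0 < ε / 4 := ENNReal.div_pos hε.ne' ENNReal.ofNat_ne_top
  obtain ⟨I, hI⟩ := ENNReal.tendsto_atTop_zero.1 hsub (ε / 4) hε4
  refine ⟨κ I, fun k hk ↦ ?_⟩
  calc sqOscSup Y τ k ω ≤ 4 * sqOscSup Y τ (κ I) ω := sqOscSup_le_four_mul hk ω
    _ ≤ 4 * (ε / 4) := by gcongr; exact hI I le_rfl
    _ = ε := ENNReal.mul_div_cancel (by norm_num) ENNReal.ofNat_ne_top

include hτ hopt hX hC hcont in
/-- **Nested stopped bounded continuous martingales are Cauchy at the terminal time.** If `Y`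
is bounded, `τ₀ ≤ τ₁ ≤ ⋯` are optional times and every `Y^{τ_k}` is a martingale with a.s.
continuous paths, then almost surely: for every `ε > 0` there is `K` such that for all
`K ≤ k ≤ J` and all times `r`, `|Y^{τ_J}_r - Y^{τ_k}_r| ≤ ε`. In particular the frozen values
`Y_{τ_k}` form a Cauchy sequence and the paths do not oscillate by more than `2ε` after `τ_K`
(the form in which "a bounded continuous local martingale on `[0, T)` has a limit at `T-`",
Revuz–Yor (1999), Ch. IV §1 / Ch. II Thm (2.10), is used for `T = sup_k τ_k`).
[cite: RevuzYor1999, Ch. II Thm (2.10)] -/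
theorem ae_nested_stoppedProcess_cauchy :
    ∀ᵐ ω ∂P, ∀ ε : ℝ, 0 < ε → ∃ K : ℕ, ∀ k, K ≤ k → ∀ J, k ≤ J → ∀ r : ℝ≥0,
      |stoppedProcess Y (τ J) r ω - stoppedProcess Y (τ k) r ω| ≤ ε := by
  filter_upwards [ae_tendsto_sqOscSup hτ hopt hX hC hcont] with ω hω ε hε
  obtain ⟨K, hK⟩ := ENNReal.tendsto_atTop_zero.1 hω (ENNReal.ofReal (ε ^ 2))
    (ENNReal.ofReal_pos.2 (by positivity))
  refine ⟨K, fun k hk J hkJ r ↦ ?_⟩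
  have h1 : ENNReal.ofReal ((stoppedProcess Y (τ J) r ω - stoppedProcess Y (τ k) r ω) ^ 2) ≤
      ENNReal.ofReal (ε ^ 2) := (ofReal_sub_sq_le_sqOscSup hkJ r ω).trans (hK k hk)
  exact abs_le_of_sq_le_sq ((ENNReal.ofReal_le_ofReal_iff (by positivity)).1 h1) hε.le

include hτ hopt hX hC hcont in
/-- **The terminal limit along finite stopping times.** Under the hypotheses of
`ae_nested_stoppedProcess_cauchy`, almost surely, if all `τ_k` are finite then there is a real
`c` (the limit of the frozen values `Y_{τ_k}`) such that for every `ε > 0`, for `K` large, all the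
paths `Y^{τ_J}`, `J ≥ K`, stay within `ε` of `c` after time `τ_K`.
[cite: RevuzYor1999, Ch. II Thm (2.10)] -/
theorem ae_nested_stoppedProcess_tendsto :
    ∀ᵐ ω ∂P, (∀ k, τ k ω ≠ ⊤) → ∃ c : ℝ, ∀ ε : ℝ, 0 < ε → ∃ K : ℕ, ∀ J, K ≤ J → ∀ r : ℝ≥0,
      τ K ω ≤ r → |stoppedProcess Y (τ J) r ω - c| ≤ ε := by
  filter_upwards [ae_nested_stoppedProcess_cauchy hτ hopt hX hC hcont] with ω hω hfin
  -- the frozen values `v k = Y_{τ_k}`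
  set v : ℕ → ℝ := fun k ↦ Y ((τ k ω).untop (hfin k)) ω with hv
  have hvX : ∀ k (r : ℝ≥0), τ k ω ≤ r → stoppedProcess Y (τ k) r ω = v k := fun k r hr ↦ by
    rw [stoppedProcess_eq_of_ge hr, hv]
    simp only
    rw [WithTop.untopA_eq_untop (hfin k)]
  -- `v` is Cauchy, hence convergent
  have hcau : CauchySeq v := by
    refine Metric.cauchySeq_iff'.2 fun ε hε ↦ ?_
    obtain ⟨K, hK⟩ := hω (ε / 2) (half_pos hε)
    refine ⟨K, fun J hJ ↦ ?_⟩
    set r : ℝ≥0 := max ((τ J ω).untop (hfin J)) ((τ K ω).untop (hfin K)) with hr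
    have hrJ : τ J ω ≤ r := by
      rw [← WithTop.coe_untop (τ J ω) (hfin J), WithTop.coe_le_coe]; exact le_max_left _ _
    have hrK : τ K ω ≤ r := by
      rw [← WithTop.coe_untop (τ K ω) (hfin K), WithTop.coe_le_coe]; exact le_max_right _ _
    have h := hK K le_rfl J hJ r
    rw [hvX J r hrJ, hvX K r hrK] at h
    rw [Real.dist_eq]
    linarith
  obtain ⟨c, hc⟩ := cauchySeq_tendsto_of_complete hcau
  refine ⟨c, fun ε hε ↦ ?_⟩
  obtain ⟨K₁, hK₁⟩ := hω (ε / 2) (half_pos hε)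
  obtain ⟨K₂, hK₂⟩ := Metric.tendsto_atTop.1 hc (ε / 2) (half_pos hε)
  refine ⟨max K₁ K₂, fun J hJ r hr ↦ ?_⟩
  have h1 : |stoppedProcess Y (τ J) r ω - stoppedProcess Y (τ (max K₁ K₂)) r ω| ≤ ε / 2 :=
    hK₁ (max K₁ K₂) (le_max_left _ _) J hJ r
  have h2 : dist (v (max K₁ K₂)) c < ε / 2 := hK₂ (max K₁ K₂) (le_max_right _ _)
  rw [hvX (max K₁ K₂) r hr] at h1
  rw [Real.dist_eq] at h2
  have h3 := abs_sub_le (stoppedProcess Y (τ J) r ω) (v (max K₁ K₂)) c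
  linarith

end Nested

end Literature.Probability.Process

end
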